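import Summits.ValiantsHypothesis.ValiantsHypothesis.Theorems.KPlusLogSqLawTropicalBToeplitzFrameless

/-!
# Route `KPlusLogSqLaw`, crux `TropicalB` — Toeplitz sector: `T ≤ T⁰ + T^framed` — splitting a chain into its frameless and framed members

HONEST FRAMING.  Helper / definition file toward the registered stubs `stub_tropThin` / `stub_tropFat` of
`Cruxes/TropicalB/Lines/birth.lean` (crux `Summit.ValiantsHypothesis.ValiantsHypothesis.Theses.KPlusLogSqLaw.TropicalB`,
ledger item `stmt-ValiantsHypothesis-19771`, route `KPlusLogSqLaw`; cell `pub-symmetroid`, seat `val-sym-trop-p3`,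
2026-08-26).  The method memo CONJT-METHOD-g22 §3.4 (e) reads Conjecture T as «T⁰ (frameless core) + framed bookkeeping»; this
file TYPES the framed half (`FramedInstanceBound`, `ConjectureTFramed` — OPEN, nothing asserted) and proves the bookkeeping
implication in the kernel: a sub-family of a chain is a chain, so the members split into the frameless ones (bounded by
`FramelessInstanceBound`) and the framed ones (bounded by `FramedInstanceBound`), whence
`LinearInstanceBound m (A + B)` and `ConjectureT0 → ConjectureTFramed → ConjectureTLinear`.  Located calibration (one seat, not
kernel): at `m = 5` a chain can carry up to `8` framed members (of the `10` framed unshared-profile permutations; such a chain has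
`12` members), while the extremal `13`-chain carries `10` frameless + `3` framed — the two halves TRADE OFF, the split is lossy
(`Φ⁰(5) + Φ^fr(5) ≥ 10 + 8 > 16 ≥ Φ_Toep(5)`).  Conjecture T / T⁰ / T^framed are OPEN; nothing here bears on `TropicalB` for general
designs, `KPlusLogSqLaw`, `MatrixDescartes` or `VP ≠ VNP`.

THE RESULTS.
* `FramedInstanceBound m Φ` («`Φ^fr_Toep(m) ≤ Φ`»: chains all of whose members are NOT frameless), `ConjectureTFramed` (OPEN Prop).
* `card_filter_members_le` — SUB-CHAINS ARE CHAINS: if every chain all of whose members satisfy a property `Q` has at most `A`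
  members, then in any chain the members satisfying `Q` number at most `A` (re-indexing by `Finset.orderEmbOfFin`).
* `linearInstanceBound_of_frameless_add_framed` — `FramelessInstanceBound m A → FramedInstanceBound m B → LinearInstanceBound m (A + B)`.
* `conjectureTLinear_of_T0_of_framed` — `ConjectureT0 → ConjectureTFramed → ConjectureTLinear` (constants add).

References: folklore; `toeplitz_window_chain_le` (`…ToeplitzWindow`, the same re-indexing); `…ToeplitzConjectureT`, `…ToeplitzFrameless`.
-/

set_option linter.dupNamespace false
set_option autoImplicit false

namespace Summit.ValiantsHypothesis.ValiantsHypothesis.Theorems.KPlusLogSqLaw.Toeplitz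

open scoped BigOperators
open Finset

/-- **«`Φ^fr_Toep(m) ≤ Φ`»**: the count of `LinearInstanceBound` restricted to families ALL of whose members are FRAMED (not
`Frameless`: some proper window `[a, a+ℓ)` is mapped into itself — the members governed by the window recursion
`toeplitz_opt_window`). [open question of the cell pub-symmetroid; no citation exists] -/
def FramedInstanceBound (m Φ : ℕ) : Prop :=
  ∀ (ψ α : ℤ → ℤ) (P : ℤ → Prop) (N : ℕ) (θ' : Fin (N + 1) → ℤ) (τ : Fin (N + 1) → Equiv.Perm (Fin m)),
    StrictMono θ' → Function.Injective τ → (∀ k, ¬ Frameless (τ k)) → (∀ k b, P ((τ k b : ℤ) - (b : ℤ))) →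
    (∀ k (σ' : Equiv.Perm (Fin m)), σ' ≠ τ k → (∀ b, P ((σ' b : ℤ) - (b : ℤ))) →
      ∑ b, (θ' k * ψ ((σ' b : ℤ) - (b : ℤ)) + α ((σ' b : ℤ) - (b : ℤ))) <
        ∑ b, (θ' k * ψ ((τ k b : ℤ) - (b : ℤ)) + α ((τ k b : ℤ) - (b : ℤ)))) →
    N + 1 ≤ Φ

/-- **CONJECTURE T^framed** (framed bookkeeping, linear form): `Φ^fr_Toep(m) = O(m)` (located: framed members `3, 7, 9, 8, 14, 8`
in the extremal chains at `m = 5..10`, up to `8` at `m = 5` in framed-rich chains).  OPEN.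
[open question of the cell pub-symmetroid; no citation exists] -/
def ConjectureTFramed : Prop := ∃ C : ℕ, ∀ m : ℕ, FramedInstanceBound m (C * m)

/-- the framed sub-count is below the full count. -/
theorem framedBound_of_linear {m Φ : ℕ} (h : LinearInstanceBound m Φ) : FramedInstanceBound m Φ :=
  fun ψ α P N θ' τ hθ hτ _ hP hopt => h ψ α P N θ' τ hθ hτ hP hopt

section Subchain

variable {m N : ℕ}

/-- **Sub-chains are chains (counting form).**  Let `Q` be a property of permutations and `A` a bound for every chain all of
whose members satisfy `Q` (hypothesis `hA`, the shape of `FramelessInstanceBound` / `FramedInstanceBound` with `Q` in place of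
`Frameless` / `¬ Frameless`).  Then along any chain the members satisfying `Q` number at most `A`: re-index them increasingly
(`Finset.orderEmbOfFin`); slopes stay strictly increasing, members stay pairwise distinct admissible unique optima. [folklore] -/
theorem card_filter_members_le (Q : Equiv.Perm (Fin m) → Prop) [DecidablePred Q] (A : ℕ)
    (hA : ∀ (ψ α : ℤ → ℤ) (P : ℤ → Prop) (M : ℕ) (θ'' : Fin (M + 1) → ℤ) (τ'' : Fin (M + 1) → Equiv.Perm (Fin m)),
      StrictMono θ'' → Function.Injective τ'' → (∀ k, Q (τ'' k)) → (∀ k b, P ((τ'' k b : ℤ) - (b : ℤ))) →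
      (∀ k (σ' : Equiv.Perm (Fin m)), σ' ≠ τ'' k → (∀ b, P ((σ' b : ℤ) - (b : ℤ))) →
        ∑ b, (θ'' k * ψ ((σ' b : ℤ) - (b : ℤ)) + α ((σ' b : ℤ) - (b : ℤ))) <
          ∑ b, (θ'' k * ψ ((τ'' k b : ℤ) - (b : ℤ)) + α ((τ'' k b : ℤ) - (b : ℤ)))) →
      M + 1 ≤ A)
    (ψ α : ℤ → ℤ) (P : ℤ → Prop) (θ' : Fin (N + 1) → ℤ) (τ : Fin (N + 1) → Equiv.Perm (Fin m))
    (hθ : StrictMono θ') (hinj : Function.Injective τ) (hτP : ∀ k b, P ((τ k b : ℤ) - (b : ℤ)))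
    (huniq : ∀ k (σ' : Equiv.Perm (Fin m)), σ' ≠ τ k → (∀ b, P ((σ' b : ℤ) - (b : ℤ))) →
      ∑ b, (θ' k * ψ ((σ' b : ℤ) - (b : ℤ)) + α ((σ' b : ℤ) - (b : ℤ))) <
        ∑ b, (θ' k * ψ ((τ k b : ℤ) - (b : ℤ)) + α ((τ k b : ℤ) - (b : ℤ)))) :
    (univ.filter fun k : Fin (N + 1) => Q (τ k)).card ≤ A := by
  set S := univ.filter fun k : Fin (N + 1) => Q (τ k) with hS
  rcases Nat.eq_zero_or_pos S.card with h0 | hpos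
  · rw [h0]; exact Nat.zero_le _
  obtain ⟨M, hM⟩ : ∃ M, S.card = M + 1 := ⟨S.card - 1, by omega⟩
  let ι := S.orderEmbOfFin hM
  have hιmem : ∀ i, ι i ∈ S := fun i => S.orderEmbOfFin_mem hM i
  have hQ : ∀ i, Q (τ (ι i)) := fun i => by
    have := hιmem i
    rw [hS, mem_filter] at this
    exact this.2
  rw [hM]
  exact hA ψ α P M (fun i => θ' (ι i)) (fun i => τ (ι i)) (fun i j hij => hθ (ι.strictMono hij))
    (fun i j hij => ι.injective (hinj hij)) hQ (fun i b => hτP (ι i) b) (fun i σ' hσ' hP' => huniq (ι i) σ' hσ' hP')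

end Subchain

/-- **`T ≤ T⁰ + T^framed`**: a frameless bound `A` and a framed bound `B` at size `m` give the full bound `A + B`. [folklore] -/
theorem linearInstanceBound_of_frameless_add_framed {m A B : ℕ} (hA : FramelessInstanceBound m A)
    (hB : FramedInstanceBound m B) : LinearInstanceBound m (A + B) := by
  intro ψ α P N θ' τ hθ hinj hτP huniq
  classical
  have h1 := card_filter_members_le (fun σ : Equiv.Perm (Fin m) => Frameless σ) A
    (fun ψ α P M θ'' τ'' a b c d e => hA ψ α P M θ'' τ'' a b c d e) ψ α P θ' τ hθ hinj hτP huniq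
  have h2 := card_filter_members_le (fun σ : Equiv.Perm (Fin m) => ¬ Frameless σ) B
    (fun ψ α P M θ'' τ'' a b c d e => hB ψ α P M θ'' τ'' a b c d e) ψ α P θ' τ hθ hinj hτP huniq
  have hsum := card_filter_add_card_filter_not (s := (univ : Finset (Fin (N + 1))))
    (fun k : Fin (N + 1) => Frameless (τ k))
  rw [card_univ, Fintype.card_fin] at hsum
  omega

/-- **`ConjectureT0 → ConjectureTFramed → ConjectureTLinear`** (constants add): the memo's «T⁰ + framed bookkeeping ⇒ T» as a
kernel implication between the typed OPEN statements. -/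
theorem conjectureTLinear_of_T0_of_framed (h0 : ConjectureT0) (hf : ConjectureTFramed) : ConjectureTLinear := by
  obtain ⟨C₀, hC₀⟩ := h0
  obtain ⟨C₁, hC₁⟩ := hf
  refine ⟨C₀ + C₁, fun m => ?_⟩
  rw [Nat.add_mul]
  exact linearInstanceBound_of_frameless_add_framed (hC₀ m) (hC₁ m)

/-- conversely both halves follow from `T` (so `T ⟺ T⁰ ∧ T^framed` at the level of linear forms). -/
theorem conjectureT0_and_framed_of_TLinear (h : ConjectureTLinear) : ConjectureT0 ∧ ConjectureTFramed := by
  refine ⟨conjectureT0_of_TLinear h, ?_⟩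
  obtain ⟨C, hC⟩ := h
  exact ⟨C, fun m => framedBound_of_linear (hC m)⟩

end Summit.ValiantsHypothesis.ValiantsHypothesis.Theorems.KPlusLogSqLaw.Toeplitz
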